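import Literature.Barriers.AtomisticToContinuum.OneDimensionalHardCoreRods
import Mathlib.Algebra.Order.ToIntervalMod
import HarnessLib

/-!
# Hard rods: rotation invariance of the Nagamiya state

`Literature/Barriers/AtomisticToContinuum/` (D-0021 barrier catalogue), sub-problem
`BoseEinsteinCondensation`; part of the typed proof of the rod barrier `OneDimensionalHardRods`
(`OneDimensionalHardCoreRods.lean`, eighth audit of `OneDimensionalHardCore`, 2026-08-16).

The rod state `rodState N L a` of `OneDimensionalHardCoreRods.lean` is Girardeau's state of the
compressed ring evaluated at the rod coordinates `x_j − a·#{i : x_i < x_j}`, which are anchored at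
the origin of the chart `[0, L)`. This file proves that it is nevertheless a function on the RING:
rotating every particle by `c` (mod `L`, `ringRotate`) leaves it invariant (`rodState_ringRotate`).
Mechanism (step (1) of the paper proof): when the chart origin passes a particle, all ranks shift
by one and that particle's coordinate by `L`, so every compressed pair difference changes by `0`
or `±L' = ±(L − Na)` (`rodCompress_ringRotate_sub`), under which `|sin(π · /L')|` is invariant;
the hard-core constraint is a function of cyclic distances (`ringDist_ringRotate`).

## References

* [MazzantiEtAl2008] F. Mazzanti et al., Phys. Rev. Lett. 100 (2008) 020401: Eqs. (2)–(3)
  (rod coordinates "corresponding to a given ordering").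
* [Nagamiya1940] T. Nagamiya, Proc. Phys.-Math. Soc. Japan 22 (1940) 705.
-/

noncomputable section

open Finset
open scoped BigOperators Real

namespace Literature.Barriers.AtomisticToContinuum.BoseGas

section Rotate

variable {N : ℕ} {L : ℝ}

/-- Rotation of the ring `ℝ/Lℤ` in the chart `[0, L)`: `u ↦ (u + c) mod L`. [folklore] -/
def ringRotate (hL : 0 < L) (c u : ℝ) : ℝ := toIcoMod hL 0 (u + c)

/-- Rotations land in the chart. [folklore] -/
theorem ringRotate_mem_Ico (hL : 0 < L) (c u : ℝ) : ringRotate hL c u ∈ Set.Ico 0 L := by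
  have h := toIcoMod_mem_Ico hL 0 (u + c)
  rwa [zero_add] at h

/-- Rotating by `c` is rotating by `c mod L`. [folklore] -/
theorem ringRotate_eq_ringRotate_toIcoMod (hL : 0 < L) (c u : ℝ) :
    ringRotate hL c u = ringRotate hL (toIcoMod hL 0 c) u := by
  unfold ringRotate
  rw [toIcoMod_eq_toIcoMod]
  refine ⟨-toIcoDiv hL 0 c, ?_⟩
  rw [show u + toIcoMod hL 0 c - (u + c) = toIcoMod hL 0 c - c by ring, toIcoMod_sub_self, neg_smul]

/-- Unwrapped points: `u + c < L` gives `(u + c) mod L = u + c` (for `u, c ≥ 0`). [folklore] -/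
theorem ringRotate_of_lt (hL : 0 < L) {c u : ℝ} (hu : 0 ≤ u) (hc : 0 ≤ c) (h : u + c < L) :
    ringRotate hL c u = u + c := by
  unfold ringRotate
  rw [toIcoMod_eq_self]
  exact ⟨by linarith, by rw [zero_add]; exact h⟩

/-- Wrapped points: `L ≤ u + c < 2L` gives `(u + c) mod L = u + c − L`. [folklore] -/
theorem ringRotate_of_ge (hL : 0 < L) {c u : ℝ} (hu : u < L) (hc : c < L) (h : L ≤ u + c) :
    ringRotate hL c u = u + c - L := by
  unfold ringRotate
  have h1 : u + c = (u + c - L) + L := by ring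
  conv_lhs => rw [h1, toIcoMod_add_right]
  exact (toIcoMod_eq_self hL).mpr ⟨by linarith, by rw [zero_add]; linarith⟩

/-- **Cyclic distances are rotation invariant** on the chart. [folklore] -/
theorem ringDist_ringRotate (hL : 0 < L) {c u v : ℝ} (hc : c ∈ Set.Ico 0 L) (hu : u ∈ Set.Ico 0 L)
    (hv : v ∈ Set.Ico 0 L) :
    ringDist L (ringRotate hL c u) (ringRotate hL c v) = ringDist L u v := by
  unfold ringDist
  by_cases hwu : u + c < L <;> by_cases hwv : v + c < L
  · rw [ringRotate_of_lt hL hu.1 hc.1 hwu, ringRotate_of_lt hL hv.1 hc.1 hwv,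
      show u + c - (v + c) = u - v by ring]
  · rw [ringRotate_of_lt hL hu.1 hc.1 hwu, ringRotate_of_ge hL hv.2 hc.2 (not_lt.mp hwv),
      show u + c - (v + c - L) = (u - v) + L by ring]
    have h1 : u - v < 0 := by linarith [not_lt.mp hwv]
    have h2 : -L < u - v := by linarith [hu.1, hv.2]
    rw [abs_of_pos (by linarith : 0 < u - v + L), abs_of_neg h1, min_comm]
    congr 1 <;> ring
  · rw [ringRotate_of_ge hL hu.2 hc.2 (not_lt.mp hwu), ringRotate_of_lt hL hv.1 hc.1 hwv,
      show u + c - L - (v + c) = (u - v) - L by ring]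
    have h1 : 0 < u - v := by linarith [not_lt.mp hwu]
    have h2 : u - v < L := by linarith [hu.2, hv.1]
    rw [abs_of_neg (by linarith : u - v - L < 0), abs_of_pos h1, min_comm]
    congr 1 <;> ring
  · rw [ringRotate_of_ge hL hu.2 hc.2 (not_lt.mp hwu), ringRotate_of_ge hL hv.2 hc.2 (not_lt.mp hwv),
      show u + c - L - (v + c - L) = u - v by ring]

/-- Admissibility is rotation invariant. [folklore] -/
theorem rodAdmissible_ringRotate_iff (hL : 0 < L) (a : ℝ) {c : ℝ} (hc : c ∈ Set.Ico 0 L)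
    {z : Fin N → ℝ} (hz : ∀ j, z j ∈ Set.Ico 0 L) :
    rodAdmissible L a (fun j => ringRotate hL c (z j)) ↔ rodAdmissible L a z := by
  unfold rodAdmissible
  simp only [ringDist_ringRotate hL hc (hz _) (hz _)]

/-! #### Ranks under rotation -/

/-- The set of particles that wrap around when rotating by `c`. [folklore] -/
def wrapped (L c : ℝ) (z : Fin N → ℝ) : Finset (Fin N) := Finset.univ.filter fun i => L ≤ z i + c

/-- Rank of an unwrapped particle after rotation: all wrapped particles pass below it.
[folklore] -/
theorem rodRank_ringRotate_of_lt (hL : 0 < L) {c : ℝ} (hc : c ∈ Set.Ico 0 L) {z : Fin N → ℝ}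
    (hz : ∀ i, z i ∈ Set.Ico 0 L) {j : Fin N} (hj : z j + c < L) :
    rodRank (fun i => ringRotate hL c (z i)) j = rodRank z j + (wrapped L c z).card := by
  unfold rodRank wrapped
  have hzj : ringRotate hL c (z j) = z j + c := ringRotate_of_lt hL (hz j).1 hc.1 hj
  have hsplit : (Finset.univ.filter fun i : Fin N => ringRotate hL c (z i) < ringRotate hL c (z j)) =
      (Finset.univ.filter fun i : Fin N => z i < z j) ∪ Finset.univ.filter fun i => L ≤ z i + c := by
    ext i
    simp only [Finset.mem_filter, Finset.mem_univ, true_and, Finset.mem_union]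
    rw [hzj]
    by_cases hwi : z i + c < L
    · rw [ringRotate_of_lt hL (hz i).1 hc.1 hwi]
      constructor
      · intro h; left; linarith
      · rintro (h | h)
        · linarith
        · exact absurd h (not_le.mpr hwi)
    · rw [ringRotate_of_ge hL (hz i).2 hc.2 (not_lt.mp hwi)]
      constructor
      · intro _; right; exact not_lt.mp hwi
      · intro _; linarith [(hz i).2, (hz j).1]
  rw [hsplit, Finset.card_union_of_disjoint]
  rw [Finset.disjoint_left]
  intro i hi hi'
  simp only [Finset.mem_filter, Finset.mem_univ, true_and] at hi hi'
  linarith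

/-- Rank of a wrapped particle after rotation: exactly the unwrapped particles (all of them below
it before) are lost. [folklore] -/
theorem rodRank_ringRotate_of_ge (hL : 0 < L) {c : ℝ} (hc : c ∈ Set.Ico 0 L) {z : Fin N → ℝ}
    (hz : ∀ i, z i ∈ Set.Ico 0 L) {j : Fin N} (hj : L ≤ z j + c) :
    rodRank (fun i => ringRotate hL c (z i)) j + (wrapped L c z)ᶜ.card = rodRank z j := by
  unfold rodRank wrapped
  have hzj : ringRotate hL c (z j) = z j + c - L := ringRotate_of_ge hL (hz j).2 hc.2 hj
  have h1 : (Finset.univ.filter fun i : Fin N => ringRotate hL c (z i) < ringRotate hL c (z j)) =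
      Finset.univ.filter fun i : Fin N => z i < z j ∧ L ≤ z i + c := by
    ext i
    simp only [Finset.mem_filter, Finset.mem_univ, true_and]
    rw [hzj]
    by_cases hwi : z i + c < L
    · rw [ringRotate_of_lt hL (hz i).1 hc.1 hwi]
      constructor
      · intro h; exfalso; linarith [(hz i).1, (hz j).2]
      · rintro ⟨_, h⟩; exact absurd h (not_le.mpr hwi)
    · rw [ringRotate_of_ge hL (hz i).2 hc.2 (not_lt.mp hwi)]
      constructor
      · intro h; exact ⟨by linarith, not_lt.mp hwi⟩
      · rintro ⟨h, _⟩; linarith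
  have h2 : (Finset.univ.filter fun i : Fin N => L ≤ z i + c)ᶜ =
      Finset.univ.filter fun i : Fin N => z i < z j ∧ ¬ L ≤ z i + c := by
    ext i
    simp only [Finset.mem_compl, Finset.mem_filter, Finset.mem_univ, true_and, not_le]
    constructor
    · intro h; exact ⟨by linarith, h⟩
    · rintro ⟨_, h⟩; exact h
  have h3 : (Finset.univ.filter fun i : Fin N => z i < z j) =
      (Finset.univ.filter fun i : Fin N => z i < z j ∧ L ≤ z i + c) ∪
        Finset.univ.filter fun i : Fin N => z i < z j ∧ ¬ L ≤ z i + c := by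
    rw [← Finset.filter_or]
    congr 1
    funext i
    exact propext ⟨fun h => (em (L ≤ z i + c)).elim (fun h' => Or.inl ⟨h, h'⟩)
      (fun h' => Or.inr ⟨h, h'⟩), fun h => h.elim (fun h => h.1) (fun h => h.1)⟩
  rw [h1, h2, h3, Finset.card_union_of_disjoint]
  rw [Finset.disjoint_left]
  intro i hi hi'
  simp only [Finset.mem_filter, Finset.mem_univ, true_and] at hi hi'
  exact hi'.2 hi.2

/-- **Compressed pair differences change by `0` or `±L'` under rotation.** [folklore] -/
theorem rodCompress_ringRotate_sub (hL : 0 < L) (a : ℝ) {c : ℝ} (hc : c ∈ Set.Ico 0 L)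
    {z : Fin N → ℝ} (hz : ∀ i, z i ∈ Set.Ico 0 L) (i j : Fin N) :
    ∃ k : ℤ, (k = 0 ∨ k = 1 ∨ k = -1) ∧
      rodCompress a (fun l => ringRotate hL c (z l)) j - rodCompress a (fun l => ringRotate hL c (z l)) i =
        (rodCompress a z j - rodCompress a z i) + k * (L - N * a) := by
  set W := wrapped L c z with hW
  have hWle : W.card ≤ N := W.card_le_univ.trans (Fintype.card_fin N).le
  have hcardc : ((Wᶜ.card : ℕ) : ℝ) = N - W.card := by
    rw [Finset.card_compl, Fintype.card_fin, Nat.cast_sub hWle]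
  -- per-particle description of the rotated compressed coordinate
  have hdesc : ∀ l : Fin N,
      (z l + c < L → rodCompress a (fun l => ringRotate hL c (z l)) l = rodCompress a z l + c - a * W.card) ∧
      (L ≤ z l + c → rodCompress a (fun l => ringRotate hL c (z l)) l =
        rodCompress a z l + c - L + a * (N - W.card)) := by
    intro l
    constructor
    · intro hl
      simp only [rodCompress]
      rw [ringRotate_of_lt hL (hz l).1 hc.1 hl, rodRank_ringRotate_of_lt hL hc hz hl, ← hW]
      push_cast; ring
    · intro hl
      simp only [rodCompress]
      have hr := rodRank_ringRotate_of_ge hL hc hz hl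
      rw [← hW] at hr
      have hr' : (rodRank (fun i => ringRotate hL c (z i)) l : ℝ) = rodRank z l - (N - W.card) := by
        rw [← hcardc]
        have hcast := congrArg (fun m : ℕ => (m : ℝ)) hr
        push_cast at hcast
        linarith
      rw [ringRotate_of_ge hL (hz l).2 hc.2 hl, hr']
      ring
  by_cases hwi : z i + c < L <;> by_cases hwj : z j + c < L
  · refine ⟨0, Or.inl rfl, ?_⟩
    rw [(hdesc j).1 hwj, (hdesc i).1 hwi]; push_cast; ring
  · refine ⟨-1, Or.inr (Or.inr rfl), ?_⟩
    rw [(hdesc j).2 (not_lt.mp hwj), (hdesc i).1 hwi]; push_cast; ring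
  · refine ⟨1, Or.inr (Or.inl rfl), ?_⟩
    rw [(hdesc j).1 hwj, (hdesc i).2 (not_lt.mp hwi)]; push_cast; ring
  · refine ⟨0, Or.inl rfl, ?_⟩
    rw [(hdesc j).2 (not_lt.mp hwj), (hdesc i).2 (not_lt.mp hwi)]; push_cast; ring

/-- `|sin(π(d + kL')/L')| = |sin(πd/L')|` for `k ∈ {0, ±1}` (also in the junk case `L' = 0`).
[folklore] -/
theorem abs_sin_add_int_mul {Lp d : ℝ} {k : ℤ} (hk : k = 0 ∨ k = 1 ∨ k = -1) :
    |Real.sin (π * (d + k * Lp) / Lp)| = |Real.sin (π * d / Lp)| := by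
  by_cases hLp : Lp = 0
  · simp [hLp]
  rcases hk with rfl | rfl | rfl
  · simp
  · have e1 : π * (d + ((1 : ℤ) : ℝ) * Lp) / Lp = π * d / Lp + π := by
      rw [Int.cast_one, one_mul, mul_add, add_div, mul_div_assoc π Lp, div_self hLp, mul_one]
    rw [e1, Real.sin_add_pi, abs_neg]
  · have e2 : π * (d + ((-1 : ℤ) : ℝ) * Lp) / Lp = π * d / Lp - π := by
      rw [Int.cast_neg, Int.cast_one, neg_one_mul, ← sub_eq_add_neg, mul_sub, sub_div,
        mul_div_assoc π Lp, div_self hLp, mul_one]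
    rw [e2, Real.sin_sub_pi, abs_neg]

/-- The Girardeau state of the compressed ring at the rod coordinates is rotation invariant.
[folklore] -/
theorem girardeauState_rodCompress_ringRotate (hL : 0 < L) (a : ℝ) {c : ℝ} (hc : c ∈ Set.Ico 0 L)
    {z : Fin N → ℝ} (hz : ∀ i, z i ∈ Set.Ico 0 L) :
    girardeauState N (L - N * a) (rodCompress a fun l => ringRotate hL c (z l)) =
      girardeauState N (L - N * a) (rodCompress a z) := by
  unfold girardeauState
  congr 1
  refine Finset.prod_congr rfl fun i _ => Finset.prod_congr rfl fun j _ => ?_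
  obtain ⟨k, hk, hdiff⟩ := rodCompress_ringRotate_sub hL a hc hz i j
  rw [hdiff, abs_sin_add_int_mul hk]

/-- **Rotation invariance of the Nagamiya state** (rotations within the chart, `c ∈ [0, L)`).
[cite: MazzantiEtAl2008, Eqs. (2)–(3)] -/
theorem rodState_ringRotate_of_mem (hL : 0 < L) (a : ℝ) {c : ℝ} (hc : c ∈ Set.Ico 0 L)
    {z : Fin N → ℝ} (hz : ∀ i, z i ∈ Set.Ico 0 L) :
    rodState N L a (fun l => ringRotate hL c (z l)) = rodState N L a z := by
  unfold rodState
  congr 1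
  by_cases hadm : rodAdmissible L a z
  · have hadm' : rodAdmissible L a (fun l => ringRotate hL c (z l)) :=
      (rodAdmissible_ringRotate_iff hL a hc hz).mpr hadm
    rw [Set.indicator_of_mem (show (fun l => ringRotate hL c (z l)) ∈
        {y : Fin N → ℝ | rodAdmissible L a y} from hadm'),
      Set.indicator_of_mem (show z ∈ {y : Fin N → ℝ | rodAdmissible L a y} from hadm)]
    exact girardeauState_rodCompress_ringRotate hL a hc hz
  · have hadm' : ¬ rodAdmissible L a (fun l => ringRotate hL c (z l)) :=
      fun h => hadm ((rodAdmissible_ringRotate_iff hL a hc hz).mp h)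
    rw [Set.indicator_of_notMem (show (fun l => ringRotate hL c (z l)) ∉
        {y : Fin N → ℝ | rodAdmissible L a y} from hadm'),
      Set.indicator_of_notMem (show z ∉ {y : Fin N → ℝ | rodAdmissible L a y} from hadm)]

/-- **Rotation invariance of the Nagamiya state**, every `c ∈ ℝ`. [cite: MazzantiEtAl2008, Eqs. (2)–(3)] -/
theorem rodState_ringRotate (hL : 0 < L) (a c : ℝ) {z : Fin N → ℝ} (hz : ∀ i, z i ∈ Set.Ico 0 L) :
    rodState N L a (fun l => ringRotate hL c (z l)) = rodState N L a z := by
  have h : (fun l => ringRotate hL c (z l)) = fun l => ringRotate hL (toIcoMod hL 0 c) (z l) := by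
    funext l; exact ringRotate_eq_ringRotate_toIcoMod hL c (z l)
  rw [h]
  have hc : toIcoMod hL 0 c ∈ Set.Ico 0 L := by
    have := toIcoMod_mem_Ico hL 0 c; rwa [zero_add] at this
  exact rodState_ringRotate_of_mem hL a hc hz

end Rotate

end Literature.Barriers.AtomisticToContinuum.BoseGas

end
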